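/-
Copyright: the b2b-balaban T⁴-continuum CRUX team, row NE7b owner lineage `t4-ne7b-p1` (gen 115). Project licence.
-/
import Summits.QuantumFields.BalabanUV.T4Continuum.Spine.NE7b.SupBackgroundLocalisation

/-!
# THE WEIGHTED MODULUS LETTERS: the background configuration `σ`, its response `Dσ` and the fluctuation covariance `C̃` of the
# perturbed skeleton depend on the coarse field EXPONENTIALLY LOCALLY at the block scale —
# `‖σw′ − σw‖_{μ,ρ∘blk} ≤ K₁(μ)‖w′ − w‖_{μ,ρ}` on the interior ball (the mean-value inequality through the conjugated map
# `e^{μρ∘blk}·σ(e^{−μρ}·)`), and the difference of two solutions of the linearised system at two backgrounds obeys the weighted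
# a-priori letter with source `P((N′(σw′) − N′(σw))h′)`, whence
# `e^{μρ(blk p)}|(C̃(w)f − C̃(w′)f)(p)|, e^{μρ(blk p)}|(Dσ(w)v − Dσ(w′)v)(p)| ≤ K₂(μ)·‖w′ − w‖_{μ,ρ}·‖f‖, ‖v‖`:
# the covariance at `p` reads the background field far from `blk p` with exponentially small weight — the DECOUPLING letter
# (row NE7b, node U5c; (63) + (62) + (58) + Mathlib's mean-value inequality BY NAME; [folklore])

Cell `pub-balaban`, sub-cell `t4`, spine estimate NE7b (`T4WeightBudget.RelWeightBound`; the cell's OWN estimate — NOT PRINTED in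
[Bałaban 1983–89], NOT PROVED).  Crux-route work under `Spine/NE7b/` by the row OWNER (`t4-ne7b-p1` gen 115) under FREEZE (0)'s
crux-prover clause (FILING-CLAIM C-ne7bp1-g115-3); NOTHING of Bałaban's is named as a Lean object, valued or asserted; no
`T4Continuum/Support` leaf typed; no `def`, no notation; zero `sorry`.  Imports (BY NAME): the owner's (63) `…SupBackgroundLocalisation`
(`weighted_apriori`; through it (62) `weighted_blockAvg`, `nonneg_of_weighted`, (58) `exists_clm_mul`, `abs_apply_le_norm`, ASE
`blockAvg_fibreProj`), Mathlib `Convex.norm_image_sub_le_of_norm_hasFDerivWithin_le`, `convex_ball`.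

WHY (located).  (63) made the background response `Dσ(w)` and the fluctuation covariance `C̃(w)` bounded between the weighted sup
spaces — data far from `blk p` are read at `p` with weight `e^{−μD}`.  A cluster ∕ decoupling expansion at the next scale needs the
same for the dependence ON THE BACKGROUND FIELD: changing `w` far from `blk p` must change `(C̃(w)f)(p)` exponentially little.
Two [folklore] steps: (i) the weighted letter for `Dσ` integrates along segments to a weighted Lipschitz letter for `σ` — the
mean-value inequality applied to the CONJUGATED map `z ↦ e^{μρ∘blk}·σ(e^{−μρ}·z)` on the convex image of the interior ball, whose
derivative `e^{μρ∘blk}∘Dσ∘e^{−μρ}` has operator norm `≤ K₁(μ)` by (63); (ii) `h = C̃(w)f` and `h′ = C̃(w′)f` solve the linearised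
system with the SAME data at two backgrounds, so `h − h′` solves it at the background `σw` with coarse datum `0` and fibre datum
`P((N′(σw′) − N′(σw))h′)`, a diagonal source of weighted size `≤ 2·L·‖σw′ − σw‖_{μ,ρ∘blk}·‖h′‖_∞` — and (63)'s `weighted_apriori`
closes.  Everything is generic in the DISPLAYED letters of (63) §4 (no re-export): a consumer feeds (63)'s objects.

WHAT IS PROVED ([folklore]; `ℓ^∞ := lp (fun _ : X d => ℝ) ∞`; `C_H(μ)`, `C_Γ(μ)` written out; weights `ρ` with `ρ x − ρ y ≤ |x − y|`,
`|ρ| ≤ M`):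
* §1 `exists_weightOps`: the weight multipliers `e^{±μρ}` (coarse) and `e^{μρ∘blk}` (fine) as `ℓ^∞ →L ℓ^∞` with displayed actions
  and `e^{−μρ}∘e^{μρ} = 1 = e^{μρ}∘e^{−μρ}`; `weighted_le_norm_mul` ∕ `norm_mul_le_of_weighted` (weighted sizes ↔ `‖e^{μρ∘blk}h‖_∞`).
* §2 **`weighted_lipschitz_of_hasFDerivAt`** (generic): if `σ : ℓ^∞ → ℓ^∞` has `HasFDerivAt σ (Dσ w) w` on `ball 0 R₀` and every `Dσ w`
  obeys the weighted letter with constant `K`, then `e^{μρ(blk p)}|(σw′ − σw)(p)| ≤ K·R` for `w, w′` in the ball whenever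
  `e^{μρ(y)}|(w′ − w)(y)| ≤ R`.
* §3 **`weighted_difference`** (`d ≥ 3`, (63) §1's rate ∕ smallness hypotheses): two `ℓ^∞` solutions `h`, `h′` of `Q′h = v`,
  `P(Ah + N′h) = κ₀` with diagonal `N′ = g·`, `N″ = g′·` (`|g|, |g′| ≤ λ`) and the same data satisfy
  `e^{μρ(blk p)}|(h − h′)(p)| ≤ (1 − 2λC_Γ(μ))⁻¹·C_Γ(μ)·2R_Δ` whenever `e^{μρ(blk q)}|(g′ q − g q)·h′ q| ≤ R_Δ`.
* §4 **`weighted_modulus_letters`** (`d ≥ 3`): for ANY `Q′, A, P, N′, σ, C̃, Dσ` with the displayed letters of (63) §4 on the interior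
  ball `ball 0 ((N⁻¹ − c)r)` (actions; `|u′| ≤ λ`, `Lip u′ ≤ L`; `HasFDerivAt σ (Dσ w) w`; the response's weighted letter; `Q′∘Dσ(w) = 1`
  and the response's fibre equation; `C̃`'s two equations and size `2(N⁻¹ − c)⁻¹`; `Dσ`'s size), every admissible `(μ, ρ)` and
  `w, w′` interior with `e^{μρ(y)}|(w′ − w)(y)| ≤ R_w`:
  (a) **`e^{μρ(blk p)}|(σw′ − σw)(p)| ≤ K₁(μ)R_w`**, `K₁(μ) = (1 − 2λC_Γ(μ))⁻¹C_H(μ)`;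
  (b) **`e^{μρ(blk p)}|(C̃(w)f − C̃(w′)f)(p)| ≤ (1 − 2λC_Γ(μ))⁻¹C_Γ(μ)·2·(L·K₁(μ)R_w·(2(N⁻¹ − c)⁻¹‖f‖))`**;
  (c) **`e^{μρ(blk p)}|(Dσ(w)v − Dσ(w′)v)(p)| ≤ (1 − 2λC_Γ(μ))⁻¹C_Γ(μ)·2·(L·K₁(μ)R_w·((N⁻¹ − c)⁻¹‖v‖))`**.
  With (63) §3's reading: a change of the background field supported at coarse distance `≥ D` from `blk p` moves `σ(p)`,
  `(C̃f)(p)`, `(Dσ v)(p)` by `≤ const·e^{−μD}` — THE DECOUPLING LETTER.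
* §5 **`exists_admissible_rate`** (`d ≥ 3`): `2λC_Γ(0) < 1` (⇐ (60)'s `2λ ≤ c < N⁻¹ ≤ N_∞⁻¹`) ⟹ `∃ μ > 0`, `μ < δ_H`, `μ < δ_u∕4`,
  `2λC_Γ(μ) < 1` — `K_d` is continuous at positive rates; so (63) and §4 hold at SOME POSITIVE RATE with no extra hypothesis.

HONEST (what this is NOT).  Constants existential ∕ useless by value; the positive rate of §5 is existential too; first-order
(Lipschitz) decoupling only — no analyticity in `w`, no cluster expansion, no polymer activities; scalar `ℤ^d` skeleton, whole
lattice, not the torus, not the covariant operators ((A3), NC-NE7b-α UNRULED); nothing of Bałaban's (A1c).  BY-NAME EFFECT ON THE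
WALL: NONE.  NE7b NOT PRINTED ∕ NOT PROVED; spine PROVED 0∕9; rung (B)+1 on a FINITE torus — NOT infinite volume, NOT the mass gap,
NOT Clay.  HONEST DEPENDENCY: continuum YM on T⁴ ⇐ BetaPertH ∧ nine spine estimates (0∕9 proved); BetaPertH ⇐ (D1) ∧ (D4) ∧
CAP+tail; G-an2-4 gates asym, D1 and NE2∕3∕4.
-/

set_option autoImplicit false

noncomputable section

namespace Summit.QuantumFields.BalabanUV.T4Continuum.NE7b.SupBackgroundDecoupling

open Set Metric Filter
open scoped ENNReal NNReal Topology
open Literature.MathematicalPhysics.QuantumFieldTheory.Balaban1983to89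
open B4Sect5Proof (latticeConst latticeConst_nonneg)
open B6QGQLower276 (X blk B mem_B AX)
open B6QGQDecay237 (deltaU deltaU_pos)
open B5Hk103ScalarZd (nbhd deltaH deltaH_pos)
open Summit.QuantumFields.BalabanUV.Beta.D1BFx.BlockColumnSupNorm (cHs cHs_nonneg)
open Summit.QuantumFields.BalabanUV.Beta.D1BFx.PointColumnSplit (cKL cG0 cSplit)
open Summit.QuantumFields.BalabanUV.Beta.D1BFx.PointColumnDecay (cFar)
open BlockPropagatorSupNorm (supConstG_nonneg)
open AugmentedSupEquivalence (blockAvg_fibreProj)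
open LocalNemytskiiSup (exists_clm_mul abs_apply_le_norm)
open OneShotChartWeightedRows (weighted_blockAvg nonneg_of_weighted)
open SupBackgroundLocalisation (weighted_apriori)

variable {d : ℕ}

/-! ## §1. The weight multipliers as operators on `ℓ^∞(ℤ^d)` -/

/-- **The weight multipliers** (bounded weight `|ρ| ≤ M`, any `μ`): `e^{μρ}·` and `e^{−μρ}·` on coarse fields and `e^{μρ∘blk}·` on fine
fields are `ℓ^∞ →L ℓ^∞` with the displayed actions, and `e^{−μρ}·(e^{μρ}·v) = v = e^{μρ}·(e^{−μρ}·v)` ((58) `exists_clm_mul`). [folklore] -/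
theorem exists_weightOps (n : ℕ) (μ : ℝ) {ρ : X d → ℝ} {M : ℝ} (hρb : ∀ y, |ρ y| ≤ M) :
    ∃ (Mw Mwi Mf : lp (fun _ : X d => ℝ) ∞ →L[ℝ] lp (fun _ : X d => ℝ) ∞),
      (∀ (v : lp (fun _ : X d => ℝ) ∞) (y : X d), Mw v y = Real.exp (μ * ρ y) * v y) ∧
      (∀ (v : lp (fun _ : X d => ℝ) ∞) (y : X d), Mwi v y = Real.exp (-(μ * ρ y)) * v y) ∧
      (∀ (h : lp (fun _ : X d => ℝ) ∞) (p : X d), Mf h p = Real.exp (μ * ρ (blk n p)) * h p) ∧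
      (∀ v : lp (fun _ : X d => ℝ) ∞, Mwi (Mw v) = v) ∧ (∀ v : lp (fun _ : X d => ℝ) ∞, Mw (Mwi v) = v) := by
  have hb : ∀ (s : ℝ) (y : X d), s = 1 ∨ s = -1 → |Real.exp (s * (μ * ρ y))| ≤ Real.exp (|μ| * M) := by
    intro s y hs
    rw [abs_of_pos (Real.exp_pos _), Real.exp_le_exp]
    have h1 : |s * (μ * ρ y)| ≤ |μ| * M := by
      rw [abs_mul, abs_mul]
      rcases hs with h | h
      · rw [h, abs_one, one_mul]; exact mul_le_mul_of_nonneg_left (hρb y) (abs_nonneg μ)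
      · rw [h, abs_neg, abs_one, one_mul]; exact mul_le_mul_of_nonneg_left (hρb y) (abs_nonneg μ)
    exact (le_abs_self _).trans h1
  have h0 : 0 ≤ Real.exp (|μ| * M) := (Real.exp_pos _).le
  obtain ⟨Mw, hMw, -⟩ := exists_clm_mul (ι := X d) (fun y => Real.exp (1 * (μ * ρ y))) h0 (fun y => hb 1 y (Or.inl rfl))
  obtain ⟨Mwi, hMwi, -⟩ := exists_clm_mul (ι := X d) (fun y => Real.exp ((-1) * (μ * ρ y))) h0 (fun y => hb (-1) y (Or.inr rfl))
  obtain ⟨Mf, hMf, -⟩ :=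
    exists_clm_mul (ι := X d) (fun p => Real.exp (1 * (μ * ρ (blk n p)))) h0 (fun p => hb 1 (blk n p) (Or.inl rfl))
  simp only [one_mul, neg_mul] at hMw hMwi hMf
  refine ⟨Mw, Mwi, Mf, hMw, hMwi, hMf, fun v => lp.ext (funext fun y => ?_), fun v => lp.ext (funext fun y => ?_)⟩
  · rw [hMwi, hMw, ← mul_assoc, ← Real.exp_add, neg_add_cancel, Real.exp_zero, one_mul]
  · rw [hMw, hMwi, ← mul_assoc, ← Real.exp_add, add_neg_cancel, Real.exp_zero, one_mul]

/-- Reading the weighted size off the multiplier: `e^{μθ(x)}|f(x)| ≤ ‖(e^{μθ}·f)‖_∞` for any operator with that displayed action.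
[folklore] -/
theorem weighted_le_norm_mul {θ : X d → ℝ} {μ : ℝ} (Mop : lp (fun _ : X d => ℝ) ∞ →L[ℝ] lp (fun _ : X d => ℝ) ∞)
    (hM : ∀ (f : lp (fun _ : X d => ℝ) ∞) (x : X d), Mop f x = Real.exp (μ * θ x) * f x)
    (f : lp (fun _ : X d => ℝ) ∞) (x : X d) : Real.exp (μ * θ x) * |f x| ≤ ‖Mop f‖ := by
  have h := abs_apply_le_norm (Mop f) x
  rwa [hM, abs_mul, abs_of_pos (Real.exp_pos _)] at h

/-- Conversely, a weighted bound `e^{μθ(x)}|f(x)| ≤ R` (`0 ≤ R`) bounds `‖e^{μθ}·f‖_∞ ≤ R`. [folklore] -/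
theorem norm_mul_le_of_weighted {θ : X d → ℝ} {μ : ℝ} (Mop : lp (fun _ : X d => ℝ) ∞ →L[ℝ] lp (fun _ : X d => ℝ) ∞)
    (hM : ∀ (f : lp (fun _ : X d => ℝ) ∞) (x : X d), Mop f x = Real.exp (μ * θ x) * f x)
    (f : lp (fun _ : X d => ℝ) ∞) {R : ℝ} (hR : 0 ≤ R) (hf : ∀ x, Real.exp (μ * θ x) * |f x| ≤ R) : ‖Mop f‖ ≤ R :=
  lp.norm_le_of_forall_le hR fun x => by
    rw [Real.norm_eq_abs, hM, abs_mul, abs_of_pos (Real.exp_pos _)]; exact hf x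

/-! ## §2. The weighted Lipschitz letter for the background configuration -/

/-- **THE WEIGHTED LIPSCHITZ LETTER, from the weighted letter of the derivative** (generic): if `σ : ℓ^∞ → ℓ^∞` has
`HasFDerivAt σ (Dσ w) w` at every `w ∈ ball 0 R₀` and every `Dσ w` maps `e^{μρ}`-weighted coarse data of size `R` to `e^{μρ∘blk}`-weighted
fine data of size `≤ K·R`, then for `w, w′` in the ball with `e^{μρ(y)}|(w′ − w)(y)| ≤ R_w`:
`e^{μρ(blk p)}|(σw′ − σw)(p)| ≤ K·R_w` — the mean-value inequality on the convex set `e^{μρ}·ball` for the conjugated map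
`z ↦ e^{μρ∘blk}·σ(e^{−μρ}·z)`, whose derivative has operator norm `≤ K`. [folklore] -/
theorem weighted_lipschitz_of_hasFDerivAt (n : ℕ) {μ : ℝ} {ρ : X d → ℝ} {M : ℝ} (hρb : ∀ y, |ρ y| ≤ M)
    {σ : lp (fun _ : X d => ℝ) ∞ → lp (fun _ : X d => ℝ) ∞}
    {Dσ : lp (fun _ : X d => ℝ) ∞ → (lp (fun _ : X d => ℝ) ∞ →L[ℝ] lp (fun _ : X d => ℝ) ∞)} {R₀ : ℝ}
    (hD : ∀ w ∈ ball (0 : lp (fun _ : X d => ℝ) ∞) R₀, HasFDerivAt σ (Dσ w) w) {K : ℝ} (hK : 0 ≤ K)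
    (hW : ∀ w ∈ ball (0 : lp (fun _ : X d => ℝ) ∞) R₀, ∀ (v : lp (fun _ : X d => ℝ) ∞) (Rv : ℝ),
      (∀ y, Real.exp (μ * ρ y) * |v y| ≤ Rv) → ∀ p : X d, Real.exp (μ * ρ (blk n p)) * |Dσ w v p| ≤ K * Rv)
    {w w' : lp (fun _ : X d => ℝ) ∞} (hw : w ∈ ball (0 : lp (fun _ : X d => ℝ) ∞) R₀)
    (hw' : w' ∈ ball (0 : lp (fun _ : X d => ℝ) ∞) R₀)
    {Rw : ℝ} (hRw : ∀ y, Real.exp (μ * ρ y) * |(w' - w) y| ≤ Rw) (p : X d) :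
    Real.exp (μ * ρ (blk n p)) * |(σ w' - σ w) p| ≤ K * Rw := by
  obtain ⟨Mw, Mwi, Mf, hMw, hMwi, hMf, hiw, -⟩ := exists_weightOps n μ hρb
  have hRw0 : 0 ≤ Rw := nonneg_of_weighted (g := id) hRw
  -- the convex set `S := (e^{−μρ}·)⁻¹(ball)` and the conjugated map on it
  have hS : Convex ℝ ((fun z : lp (fun _ : X d => ℝ) ∞ => Mwi z) ⁻¹' ball (0 : lp (fun _ : X d => ℝ) ∞) R₀) :=
    (convex_ball _ _).is_linear_preimage ⟨fun x y => map_add Mwi x y, fun c x => map_smul Mwi c x⟩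
  have hderiv : ∀ z ∈ (fun z : lp (fun _ : X d => ℝ) ∞ => Mwi z) ⁻¹' ball (0 : lp (fun _ : X d => ℝ) ∞) R₀,
      HasFDerivWithinAt (fun z => Mf (σ (Mwi z))) (Mf.comp ((Dσ (Mwi z)).comp Mwi))
        ((fun z : lp (fun _ : X d => ℝ) ∞ => Mwi z) ⁻¹' ball (0 : lp (fun _ : X d => ℝ) ∞) R₀) z := fun z hz =>
    (Mf.hasFDerivAt.comp z ((hD (Mwi z) hz).comp z Mwi.hasFDerivAt)).hasFDerivWithinAt
  have hbound : ∀ z ∈ (fun z : lp (fun _ : X d => ℝ) ∞ => Mwi z) ⁻¹' ball (0 : lp (fun _ : X d => ℝ) ∞) R₀,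
      ‖Mf.comp ((Dσ (Mwi z)).comp Mwi)‖ ≤ K := fun z hz => by
    refine ContinuousLinearMap.opNorm_le_bound _ hK fun u => ?_
    rw [ContinuousLinearMap.comp_apply, ContinuousLinearMap.comp_apply]
    refine norm_mul_le_of_weighted Mf hMf _ (mul_nonneg hK (norm_nonneg u)) (hW (Mwi z) hz (Mwi u) ‖u‖ fun y => ?_)
    rw [hMwi, abs_mul, ← mul_assoc, abs_of_pos (Real.exp_pos _), ← Real.exp_add, add_neg_cancel, Real.exp_zero, one_mul]
    exact abs_apply_le_norm u y
  have hzw : Mw w ∈ (fun z : lp (fun _ : X d => ℝ) ∞ => Mwi z) ⁻¹' ball (0 : lp (fun _ : X d => ℝ) ∞) R₀ := by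
    show Mwi (Mw w) ∈ ball (0 : lp (fun _ : X d => ℝ) ∞) R₀; rw [hiw]; exact hw
  have hzw' : Mw w' ∈ (fun z : lp (fun _ : X d => ℝ) ∞ => Mwi z) ⁻¹' ball (0 : lp (fun _ : X d => ℝ) ∞) R₀ := by
    show Mwi (Mw w') ∈ ball (0 : lp (fun _ : X d => ℝ) ∞) R₀; rw [hiw]; exact hw'
  have hMVT := hS.norm_image_sub_le_of_norm_hasFDerivWithin_le hderiv hbound hzw hzw'
  -- read it back: `Φ(e^{μρ}w) = e^{μρ∘blk}σ(w)`
  rw [hiw, hiw, ← map_sub, ← map_sub] at hMVT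
  have h1 := weighted_le_norm_mul Mf hMf (σ w' - σ w) p
  have h2 : ‖Mw (w' - w)‖ ≤ Rw := norm_mul_le_of_weighted Mw hMw _ hRw0 hRw
  exact h1.trans (hMVT.trans ((mul_le_mul_of_nonneg_left h2 hK).trans le_rfl))

/-! ## §3. Two solutions at two backgrounds: the weighted letter for the difference -/

/-- **THE WEIGHTED LETTER FOR THE DIFFERENCE OF TWO SOLUTIONS AT TWO BACKGROUNDS** (`d ≥ 3`; (63) §1's hypotheses): if `h` solves
`Q′h = v`, `P(Ah + g·h) = κ₀` and `h′` solves `Q′h′ = v`, `P(Ah′ + g′·h′) = κ₀` (same data, diagonal multipliers `|g|, |g′| ≤ λ`),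
then `h − h′` solves the system at `g` with data `(0, P((g′ − g)·h′))`, and
`e^{μρ(blk p)}|(h − h′)(p)| ≤ (1 − 2λC_Γ(μ))⁻¹·C_Γ(μ)·2R_Δ` whenever `e^{μρ(blk q)}|(g′(q) − g(q))h′(q)| ≤ R_Δ`. [folklore] -/
theorem weighted_difference (hd : 3 ≤ d) (n : ℕ) {a : ℝ} (ha : 0 < a)
    (Dop Aop Pop Nop Nop' : lp (fun _ : X d => ℝ) ∞ →L[ℝ] lp (fun _ : X d => ℝ) ∞)
    (hD : ∀ (f : lp (fun _ : X d => ℝ) ∞) (y : X d), Dop f y = (((n : ℝ) + 1) ^ d)⁻¹ * ∑ p ∈ B n y, f p)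
    (hA : ∀ (f : lp (fun _ : X d => ℝ) ∞) (p : X d), Aop f p = ∑ r ∈ nbhd n p, AX n a p r * f r)
    (hP : ∀ (f : lp (fun _ : X d => ℝ) ∞) (p : X d), Pop f p = f p - (((n : ℝ) + 1) ^ d)⁻¹ * ∑ p' ∈ B n (blk n p), f p')
    {g g' : X d → ℝ} {lam : ℝ} (hN : ∀ (f : lp (fun _ : X d => ℝ) ∞) (p : X d), Nop f p = g p * f p)
    (hN' : ∀ (f : lp (fun _ : X d => ℝ) ∞) (p : X d), Nop' f p = g' p * f p) (hg : ∀ p, |g p| ≤ lam)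
    (hg' : ∀ p, |g' p| ≤ lam)
    {μ : ℝ} (hμ0 : 0 ≤ μ) (hμH : μ < deltaH d a) (hμU : μ < deltaU d a / 4)
    (hsmall : 2 * lam * (((cG0 d * cKL d (d - 2) + cSplit d a) * Real.exp (2 * deltaU d a)
        + cFar d a * Real.exp (4 * deltaU d a) / deltaU d a ^ 2) * latticeConst d (deltaU d a / 4 - μ)
          * (1 + cHs d a * latticeConst d (deltaH d a - μ))) < 1)
    {ρ : X d → ℝ} (hρ : ∀ x y, ρ x - ρ y ≤ dist x y) {Mρ : ℝ} (hρb : ∀ y, |ρ y| ≤ Mρ)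
    (h h' v κ₀ : lp (fun _ : X d => ℝ) ∞) (h1 : Dop h = v) (h2 : Pop (Aop h + Nop h) = κ₀) (h1' : Dop h' = v)
    (h2' : Pop (Aop h' + Nop' h') = κ₀)
    {RΔ : ℝ} (hΔ : ∀ q, Real.exp (μ * ρ (blk n q)) * |(g' q - g q) * h' q| ≤ RΔ) (p : X d) :
    Real.exp (μ * ρ (blk n p)) * |(h - h') p|
      ≤ (1 - 2 * lam * (((cG0 d * cKL d (d - 2) + cSplit d a) * Real.exp (2 * deltaU d a)
            + cFar d a * Real.exp (4 * deltaU d a) / deltaU d a ^ 2) * latticeConst d (deltaU d a / 4 - μ)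
              * (1 + cHs d a * latticeConst d (deltaH d a - μ))))⁻¹
        * (((cG0 d * cKL d (d - 2) + cSplit d a) * Real.exp (2 * deltaU d a)
              + cFar d a * Real.exp (4 * deltaU d a) / deltaU d a ^ 2) * latticeConst d (deltaU d a / 4 - μ)
                * (1 + cHs d a * latticeConst d (deltaH d a - μ)) * (2 * RΔ)) := by
  have hlam : 0 ≤ lam := (abs_nonneg _).trans (hg 0)
  -- the diagonal source `(g′ − g)·h′`
  have hgg : ∀ q, |g' q - g q| ≤ lam + lam := fun q => (abs_sub _ _).trans (add_le_add (hg' q) (hg q))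
  obtain ⟨Mop, hMop, -⟩ := exists_clm_mul (ι := X d) (fun q => g' q - g q) (by positivity) hgg
  have hMN : Nop' h' - Nop h' = Mop h' :=
    lp.ext (funext fun q => by rw [lp.coeFn_sub, Pi.sub_apply, hN, hN', hMop]; ring)
  have h1k : Dop (h - h') = 0 := by rw [map_sub, h1, h1', sub_self]
  have h2k : Pop (Aop (h - h') + Nop (h - h')) = Pop (Mop h') := by
    have e : Aop (h - h') + Nop (h - h') = (Aop h + Nop h) - (Aop h' + Nop' h') + Mop h' := by
      rw [← hMN, map_sub, map_sub]; abel
    rw [e, map_add, map_sub, h2, h2', sub_self, zero_add]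
  -- its weighted size `≤ 2R_Δ` after `P`
  have hΔ' : ∀ q, Real.exp (μ * ρ (blk n q)) * |Mop h' q| ≤ RΔ := fun q => by rw [hMop]; exact hΔ q
  have hκ : ∀ q, Real.exp (μ * ρ (blk n q)) * |Pop (Mop h') q| ≤ 2 * RΔ := fun q => by
    have havg := weighted_blockAvg n (μ := μ) (ρ := ρ) (f := fun p' => Mop h' p') hΔ' (blk n q)
    have hE : 0 ≤ Real.exp (μ * ρ (blk n q)) := (Real.exp_pos _).le
    rw [hP]
    calc _ ≤ Real.exp (μ * ρ (blk n q)) * (|Mop h' q| + |(((n : ℝ) + 1) ^ d)⁻¹ * ∑ p' ∈ B n (blk n q), Mop h' p'|) :=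
          mul_le_mul_of_nonneg_left (abs_sub _ _) hE
      _ ≤ RΔ + RΔ := by rw [mul_add]; exact add_le_add (hΔ' q) havg
      _ = 2 * RΔ := by ring
  have hz : ∀ y : X d, Real.exp (μ * ρ y) * |(0 : lp (fun _ : X d => ℝ) ∞) y| ≤ 0 := fun y => by
    rw [lp.coeFn_zero, Pi.zero_apply, abs_zero, mul_zero]
  have hmain := weighted_apriori hd n ha Dop Aop Pop Nop hD hA hP hN hg hμ0 hμH hμU hsmall hρ hρb (h - h') 0 (Pop (Mop h'))
    (blockAvg_fibreProj hD hP _) h1k h2k hz hκ p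
  rw [mul_zero, zero_add] at hmain
  exact hmain

/-! ## §4. The weighted modulus letters of the background, its response and the fluctuation covariance -/

/-- **THE WEIGHTED MODULUS LETTERS** (`d ≥ 3`), generic in the displayed letters of (63) §4 on the interior ball `ball 0 R₀`:
for every admissible `(μ, ρ)` (`0 ≤ μ < δ_H`, `μ < δ_u∕4`, `2λC_Γ(μ) < 1`, `ρ` bounded 1-Lipschitz) and interior `w, w′` with
`e^{μρ(y)}|(w′ − w)(y)| ≤ R_w`: (a) `e^{μρ(blk p)}|(σw′ − σw)(p)| ≤ K₁(μ)R_w`, `K₁(μ) = (1 − 2λC_Γ(μ))⁻¹C_H(μ)`; (b) the covariance: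
`e^{μρ(blk p)}|(C̃(w)f − C̃(w′)f)(p)| ≤ (1 − 2λC_Γ(μ))⁻¹C_Γ(μ)·2·(L·K₁(μ)R_w·(K_C‖f‖))`; (c) the response:
`e^{μρ(blk p)}|(Dσ(w)v − Dσ(w′)v)(p)| ≤ (1 − 2λC_Γ(μ))⁻¹C_Γ(μ)·2·(L·K₁(μ)R_w·(K_D‖v‖))` — THE DECOUPLING LETTERS: with (63) §3,
a change of the coarse field at coarse distance `≥ D` from `blk p` moves `σ(p)`, `(C̃f)(p)`, `(Dσ v)(p)` by `O(e^{−μD})`. [folklore] -/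
theorem weighted_modulus_letters (hd : 3 ≤ d) (n : ℕ) {a : ℝ} (ha : 0 < a)
    (Dop Aop Pop : lp (fun _ : X d => ℝ) ∞ →L[ℝ] lp (fun _ : X d => ℝ) ∞)
    (N' : lp (fun _ : X d => ℝ) ∞ → (lp (fun _ : X d => ℝ) ∞ →L[ℝ] lp (fun _ : X d => ℝ) ∞))
    (σ : lp (fun _ : X d => ℝ) ∞ → lp (fun _ : X d => ℝ) ∞)
    (Cf Dσ : lp (fun _ : X d => ℝ) ∞ → (lp (fun _ : X d => ℝ) ∞ →L[ℝ] lp (fun _ : X d => ℝ) ∞))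
    (hD : ∀ (f : lp (fun _ : X d => ℝ) ∞) (y : X d), Dop f y = (((n : ℝ) + 1) ^ d)⁻¹ * ∑ p ∈ B n y, f p)
    (hA : ∀ (f : lp (fun _ : X d => ℝ) ∞) (p : X d), Aop f p = ∑ r ∈ nbhd n p, AX n a p r * f r)
    (hP : ∀ (f : lp (fun _ : X d => ℝ) ∞) (p : X d), Pop f p = f p - (((n : ℝ) + 1) ^ d)⁻¹ * ∑ p' ∈ B n (blk n p), f p')
    {u' : ℝ → ℝ} {lam : ℝ} (hN'app : ∀ (φ f : lp (fun _ : X d => ℝ) ∞) (p : X d), N' φ f p = u' (φ p) * f p)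
    (hlam : ∀ t, |u' t| ≤ lam) {L : ℝ} (hL0 : 0 ≤ L) (hL : ∀ s t, |u' s - u' t| ≤ L * |s - t|)
    {R₀ KC KD : ℝ}
    (hDσ : ∀ w ∈ ball (0 : lp (fun _ : X d => ℝ) ∞) R₀, HasFDerivAt σ (Dσ w) w)
    (hDn : ∀ w ∈ ball (0 : lp (fun _ : X d => ℝ) ∞) R₀, ∀ v : lp (fun _ : X d => ℝ) ∞, ‖Dσ w v‖ ≤ KD * ‖v‖)
    (hDD : ∀ w ∈ ball (0 : lp (fun _ : X d => ℝ) ∞) R₀, ∀ v : lp (fun _ : X d => ℝ) ∞, Dop (Dσ w v) = v)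
    (hDfib : ∀ w ∈ ball (0 : lp (fun _ : X d => ℝ) ∞) R₀, ∀ v : lp (fun _ : X d => ℝ) ∞,
      Pop (Aop (Dσ w v) + N' (σ w) (Dσ w v)) = 0)
    (hC1 : ∀ w ∈ ball (0 : lp (fun _ : X d => ℝ) ∞) R₀, ∀ f : lp (fun _ : X d => ℝ) ∞, Dop (Cf w f) = 0)
    (hC2 : ∀ w ∈ ball (0 : lp (fun _ : X d => ℝ) ∞) R₀, ∀ f : lp (fun _ : X d => ℝ) ∞,
      Pop (Aop (Cf w f) + N' (σ w) (Cf w f)) = Pop f)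
    (hC4 : ∀ w ∈ ball (0 : lp (fun _ : X d => ℝ) ∞) R₀, ∀ f : lp (fun _ : X d => ℝ) ∞, ‖Cf w f‖ ≤ KC * ‖f‖)
    {μ : ℝ} (hμ0 : 0 ≤ μ) (hμH : μ < deltaH d a) (hμU : μ < deltaU d a / 4)
    (hsmall : 2 * lam * (((cG0 d * cKL d (d - 2) + cSplit d a) * Real.exp (2 * deltaU d a)
        + cFar d a * Real.exp (4 * deltaU d a) / deltaU d a ^ 2) * latticeConst d (deltaU d a / 4 - μ)
          * (1 + cHs d a * latticeConst d (deltaH d a - μ))) < 1)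
    {ρ : X d → ℝ} (hρ : ∀ x y, ρ x - ρ y ≤ dist x y) {Mρ : ℝ} (hρb : ∀ y, |ρ y| ≤ Mρ)
    (hDwt : ∀ w ∈ ball (0 : lp (fun _ : X d => ℝ) ∞) R₀, ∀ (v : lp (fun _ : X d => ℝ) ∞) (Rv : ℝ),
      (∀ y, Real.exp (μ * ρ y) * |v y| ≤ Rv) → ∀ p : X d, Real.exp (μ * ρ (blk n p)) * |Dσ w v p|
        ≤ (1 - 2 * lam * (((cG0 d * cKL d (d - 2) + cSplit d a) * Real.exp (2 * deltaU d a)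
            + cFar d a * Real.exp (4 * deltaU d a) / deltaU d a ^ 2) * latticeConst d (deltaU d a / 4 - μ)
              * (1 + cHs d a * latticeConst d (deltaH d a - μ))))⁻¹ * (cHs d a * latticeConst d (deltaH d a - μ) * Rv))
    {w w' : lp (fun _ : X d => ℝ) ∞} (hw : w ∈ ball (0 : lp (fun _ : X d => ℝ) ∞) R₀)
    (hw' : w' ∈ ball (0 : lp (fun _ : X d => ℝ) ∞) R₀) {Rw : ℝ} (hRw : ∀ y, Real.exp (μ * ρ y) * |(w' - w) y| ≤ Rw) :
    (∀ p : X d, Real.exp (μ * ρ (blk n p)) * |(σ w' - σ w) p|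
        ≤ (1 - 2 * lam * (((cG0 d * cKL d (d - 2) + cSplit d a) * Real.exp (2 * deltaU d a)
            + cFar d a * Real.exp (4 * deltaU d a) / deltaU d a ^ 2) * latticeConst d (deltaU d a / 4 - μ)
              * (1 + cHs d a * latticeConst d (deltaH d a - μ))))⁻¹ * (cHs d a * latticeConst d (deltaH d a - μ)) * Rw) ∧
    (∀ (f : lp (fun _ : X d => ℝ) ∞) (p : X d), Real.exp (μ * ρ (blk n p)) * |(Cf w f - Cf w' f) p|
        ≤ (1 - 2 * lam * (((cG0 d * cKL d (d - 2) + cSplit d a) * Real.exp (2 * deltaU d a)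
            + cFar d a * Real.exp (4 * deltaU d a) / deltaU d a ^ 2) * latticeConst d (deltaU d a / 4 - μ)
              * (1 + cHs d a * latticeConst d (deltaH d a - μ))))⁻¹
          * (((cG0 d * cKL d (d - 2) + cSplit d a) * Real.exp (2 * deltaU d a)
              + cFar d a * Real.exp (4 * deltaU d a) / deltaU d a ^ 2) * latticeConst d (deltaU d a / 4 - μ)
                * (1 + cHs d a * latticeConst d (deltaH d a - μ))
            * (2 * (L * ((1 - 2 * lam * (((cG0 d * cKL d (d - 2) + cSplit d a) * Real.exp (2 * deltaU d a)
                + cFar d a * Real.exp (4 * deltaU d a) / deltaU d a ^ 2) * latticeConst d (deltaU d a / 4 - μ)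
                  * (1 + cHs d a * latticeConst d (deltaH d a - μ))))⁻¹ * (cHs d a * latticeConst d (deltaH d a - μ)) * Rw)
              * (KC * ‖f‖))))) ∧
    (∀ (v : lp (fun _ : X d => ℝ) ∞) (p : X d), Real.exp (μ * ρ (blk n p)) * |(Dσ w v - Dσ w' v) p|
        ≤ (1 - 2 * lam * (((cG0 d * cKL d (d - 2) + cSplit d a) * Real.exp (2 * deltaU d a)
            + cFar d a * Real.exp (4 * deltaU d a) / deltaU d a ^ 2) * latticeConst d (deltaU d a / 4 - μ)
              * (1 + cHs d a * latticeConst d (deltaH d a - μ))))⁻¹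
          * (((cG0 d * cKL d (d - 2) + cSplit d a) * Real.exp (2 * deltaU d a)
              + cFar d a * Real.exp (4 * deltaU d a) / deltaU d a ^ 2) * latticeConst d (deltaU d a / 4 - μ)
                * (1 + cHs d a * latticeConst d (deltaH d a - μ))
            * (2 * (L * ((1 - 2 * lam * (((cG0 d * cKL d (d - 2) + cSplit d a) * Real.exp (2 * deltaU d a)
                + cFar d a * Real.exp (4 * deltaU d a) / deltaU d a ^ 2) * latticeConst d (deltaU d a / 4 - μ)
                  * (1 + cHs d a * latticeConst d (deltaH d a - μ))))⁻¹ * (cHs d a * latticeConst d (deltaH d a - μ)) * Rw)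
              * (KD * ‖v‖))))) := by
  have hlam0 : 0 ≤ lam := (abs_nonneg _).trans (hlam 0)
  have hCH : 0 ≤ cHs d a * latticeConst d (deltaH d a - μ) :=
    mul_nonneg (cHs_nonneg d ha) (latticeConst_nonneg d (sub_pos.2 hμH).le)
  have hK0 : 0 ≤ (1 - 2 * lam * (((cG0 d * cKL d (d - 2) + cSplit d a) * Real.exp (2 * deltaU d a)
      + cFar d a * Real.exp (4 * deltaU d a) / deltaU d a ^ 2) * latticeConst d (deltaU d a / 4 - μ)
        * (1 + cHs d a * latticeConst d (deltaH d a - μ))))⁻¹ := inv_nonneg.2 (sub_pos.2 hsmall).le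
  have hK1 := mul_nonneg hK0 hCH
  -- (a) the background configuration
  have ha' : ∀ q : X d, Real.exp (μ * ρ (blk n q)) * |(σ w' - σ w) q|
      ≤ (1 - 2 * lam * (((cG0 d * cKL d (d - 2) + cSplit d a) * Real.exp (2 * deltaU d a)
          + cFar d a * Real.exp (4 * deltaU d a) / deltaU d a ^ 2) * latticeConst d (deltaU d a / 4 - μ)
            * (1 + cHs d a * latticeConst d (deltaH d a - μ))))⁻¹ * (cHs d a * latticeConst d (deltaH d a - μ)) * Rw :=
    fun q => weighted_lipschitz_of_hasFDerivAt n hρb hDσ hK1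
      (fun x hx v Rv hv q' => (hDwt x hx v Rv hv q').trans_eq (by ring)) hw hw' hRw q
  -- the diagonal sources `(u′∘σw′ − u′∘σw)·h′`
  have hsrc : ∀ (h' : lp (fun _ : X d => ℝ) ∞) (K' : ℝ), ‖h'‖ ≤ K' → ∀ q : X d,
      Real.exp (μ * ρ (blk n q)) * |(u' (σ w' q) - u' (σ w q)) * h' q|
        ≤ L * ((1 - 2 * lam * (((cG0 d * cKL d (d - 2) + cSplit d a) * Real.exp (2 * deltaU d a)
            + cFar d a * Real.exp (4 * deltaU d a) / deltaU d a ^ 2) * latticeConst d (deltaU d a / 4 - μ)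
              * (1 + cHs d a * latticeConst d (deltaH d a - μ))))⁻¹ * (cHs d a * latticeConst d (deltaH d a - μ)) * Rw)
          * K' := by
    intro h' K' hK' q
    have h1 := hL (σ w' q) (σ w q)
    have h2 := ha' q
    have h3 : |h' q| ≤ K' := (abs_apply_le_norm h' q).trans hK'
    have hE : 0 ≤ Real.exp (μ * ρ (blk n q)) := (Real.exp_pos _).le
    rw [abs_mul]
    calc Real.exp (μ * ρ (blk n q)) * (|u' (σ w' q) - u' (σ w q)| * |h' q|)
        ≤ Real.exp (μ * ρ (blk n q)) * ((L * |σ w' q - σ w q|) * K') :=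
          mul_le_mul_of_nonneg_left (mul_le_mul h1 h3 (abs_nonneg _) (by positivity)) hE
      _ = L * (Real.exp (μ * ρ (blk n q)) * |(σ w' - σ w) q|) * K' := by rw [lp.coeFn_sub, Pi.sub_apply]; ring
      _ ≤ _ := mul_le_mul_of_nonneg_right (mul_le_mul_of_nonneg_left h2 hL0) ((norm_nonneg h').trans hK')
  refine ⟨ha', fun f p => ?_, fun v p => ?_⟩
  · -- (b) the covariance: `h = C̃(w)f` at `g = u′∘σw`, `h′ = C̃(w′)f` at `g′ = u′∘σw′`, data `(0, Pf)`
    exact weighted_difference hd n ha Dop Aop Pop (N' (σ w)) (N' (σ w')) hD hA hP (hN'app (σ w)) (hN'app (σ w'))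
      (fun q => hlam _) (fun q => hlam _) hμ0 hμH hμU hsmall hρ hρb (Cf w f) (Cf w' f) 0 (Pop f) (hC1 w hw f) (hC2 w hw f)
      (hC1 w' hw' f) (hC2 w' hw' f) (hsrc (Cf w' f) (KC * ‖f‖) (hC4 w' hw' f)) p
  · -- (c) the response: `h = Dσ(w)v`, `h′ = Dσ(w′)v`, data `(v, 0)`
    exact weighted_difference hd n ha Dop Aop Pop (N' (σ w)) (N' (σ w')) hD hA hP (hN'app (σ w)) (hN'app (σ w'))
      (fun q => hlam _) (fun q => hlam _) hμ0 hμH hμU hsmall hρ hρb (Dσ w v) (Dσ w' v) v 0 (hDD w hw v) (hDfib w hw v)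
      (hDD w' hw' v) (hDfib w' hw' v) (hsrc (Dσ w' v) (KD * ‖v‖) (hDn w' hw' v)) p


/-! ## §5. A positive admissible rate exists -/

/-- **A POSITIVE ADMISSIBLE RATE EXISTS** (`d ≥ 3`): if the smallness holds at rate `0` — `2λ·C_Γ(0) < 1`, which (60)'s `2λ ≤ c < N⁻¹`,
`N ≥ N_∞ = C_H(0) + C_Γ(0)` give — then some `μ > 0` with `μ < δ_H`, `μ < δ_u∕4` has `2λ·C_Γ(μ) < 1`: `K_d` is continuous at
positive rates, so (63) ∕ §4 hold at a POSITIVE decay rate (existential). [folklore] -/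
theorem exists_admissible_rate (hd : 3 ≤ d) {a : ℝ} (ha : 0 < a) {lam : ℝ}
    (h0 : 2 * lam * (((cG0 d * cKL d (d - 2) + cSplit d a) * Real.exp (2 * deltaU d a)
        + cFar d a * Real.exp (4 * deltaU d a) / deltaU d a ^ 2) * latticeConst d (deltaU d a / 4)
          * (1 + cHs d a * latticeConst d (deltaH d a))) < 1) :
    ∃ μ : ℝ, 0 < μ ∧ μ < deltaH d a ∧ μ < deltaU d a / 4 ∧
      2 * lam * (((cG0 d * cKL d (d - 2) + cSplit d a) * Real.exp (2 * deltaU d a)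
        + cFar d a * Real.exp (4 * deltaU d a) / deltaU d a ^ 2) * latticeConst d (deltaU d a / 4 - μ)
          * (1 + cHs d a * latticeConst d (deltaH d a - μ))) < 1 := by
  have hδH := deltaH_pos d ha
  have hδU := deltaU_pos d ha
  have hδU4 : 0 < deltaU d a / 4 := by positivity
  have hd0 : (0 : ℝ) < d := by exact_mod_cast (show 0 < d by omega)
  -- `K_d(b₀ − ·)` is continuous at `0` for `b₀ > 0`
  have hcont : ∀ b₀ : ℝ, 0 < b₀ →
      Filter.Tendsto (fun μ : ℝ => latticeConst d (b₀ - μ)) (𝓝 0) (𝓝 (latticeConst d b₀)) := by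
    intro b₀ hb₀
    have hne : (fun μ : ℝ => 1 - Real.exp (-((b₀ - μ) / (d : ℝ)))) 0 ≠ 0 := by
      have h1 : Real.exp (-((b₀ - 0) / (d : ℝ))) < 1 := by
        rw [← Real.exp_zero]
        exact Real.exp_lt_exp.2 (by rw [sub_zero]; exact neg_neg_of_pos (div_pos hb₀ hd0))
      show 1 - Real.exp (-((b₀ - 0) / (d : ℝ))) ≠ 0
      linarith
    have hc : ContinuousAt (fun μ : ℝ => ((2 : ℝ) * (1 - Real.exp (-((b₀ - μ) / (d : ℝ))))⁻¹) ^ d) 0 :=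
      (continuousAt_const.mul
        (ContinuousAt.inv₀ (f := fun μ : ℝ => 1 - Real.exp (-((b₀ - μ) / (d : ℝ)))) (by fun_prop) hne)).pow d
    simpa only [latticeConst, sub_zero] using hc.tendsto
  have hF := (((hcont _ hδU4).const_mul ((cG0 d * cKL d (d - 2) + cSplit d a) * Real.exp (2 * deltaU d a)
      + cFar d a * Real.exp (4 * deltaU d a) / deltaU d a ^ 2)).mul
    (((hcont _ hδH).const_mul (cHs d a)).const_add 1)).const_mul (2 * lam)
  have hev := hF.eventually_lt tendsto_const_nhds h0
  obtain ⟨ε, hε, hεp⟩ := Metric.eventually_nhds_iff.1 hev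
  refine ⟨min (ε / 2) (min (deltaH d a / 2) (deltaU d a / 8)), by positivity, ?_, ?_, ?_⟩
  · exact (min_le_right _ _).trans_lt ((min_le_left _ _).trans_lt (by linarith))
  · exact (min_le_right _ _).trans_lt ((min_le_right _ _).trans_lt (by linarith))
  · have hμε : dist (min (ε / 2) (min (deltaH d a / 2) (deltaU d a / 8))) 0 < ε := by
      rw [Real.dist_eq, sub_zero, abs_of_pos (by positivity)]
      exact (min_le_left _ _).trans_lt (by linarith)
    exact hεp hμε

end Summit.QuantumFields.BalabanUV.T4Continuum.NE7b.SupBackgroundDecoupling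

end
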